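import Mathlib.Algebra.DualNumber
import Mathlib.RingTheory.Ideal.Maps
import Mathlib.RingTheory.Ideal.Quotient.Operations
import Mathlib.RingTheory.Flat.Basic
import Summits.Ventures.HSemireg.DualNumberFlatCriterion
import HarnessLib

/-!
# Venture HSemireg — embedded first-order deformations of `V(I) ⊂ Spec R` are `Hom_R(I, R/I)`
# (Hartshorne, *Deformation Theory*, Prop. 2.3 / Thm. 2.4, affine case) — the local dictionary behind (H-arr)

HONEST FRAMING.  Part of the Lean side of the computation cell `pub-hsemireg` (track «S4-PUSH» (ii), seat
s4-prove-3, second route for (S5)).  The (S5) files `ObstructionLocus*` (seat s4-prove-2) type the closed forms of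
STRUCTURE.md §2 (S5)/(S-B) with the geometry as NAMED HYPOTHESIS SHAPES; the shape (H-arr) («`ob_F(ξ) = 0` ⟹ every
governing branch follows `ξ`») uses, for literal ideal sheaves, the DICTIONARY «first-order embedded deformations of
`Z = V(I)` ↔ sections of the normal sheaf `Hom(I, O_Z)`» — named there as an untyped input (Hartshorne, Thm. 2.4) and
composed with the LOCAL LEMMA L1 (`ObstructionLocusLocalLemma`: `Hom_R(I_W, R/I_W) = ⊕_k Ann(x_k)`).  THIS FILE proves
the affine case of that dictionary as plain commutative algebra, for EVERY commutative ring `R` and EVERY ideal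
`I ⊆ R`, in Mathlib's model `R[ε] = DualNumber R = TrivSqZeroExt R R` of `B' = B[t]/t²`:
* `liftIdeal I φ = {x + εy : x ∈ I, ȳ = φ(x)}` — Hartshorne's `I'` attached to `φ ∈ Hom_R(I, R/I)`; `liftIdeal_zero`:
  `φ = 0` ↔ the trivial deformation `I ⊕ εI = I·R[ε]`;
* `IsEmbeddedDeformation I J` — «the image of `J` in `R` is `I`» (`fst_mem`, `exists_mem`; ⟺ `J.map fst = I`,
  `map_fstHom_eq_iff`) and «`R[ε]/J` is flat over the dual numbers» in the intrinsic form `(J : ε) = J + εR[ε]`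
  (`eps_flat`; ⟺ `Module.Flat k[ε] (R[ε] ⧸ J)` for any `k[ε]`-algebra structure with `ε ↦ ε`, `k` a field:
  `eps_flat_iff_flat`, via `DualNumberFlat.flat_iff_forall_exists_eq_eps_smul`; the canonical structure
  `algebraDualNumber` of a `k`-algebra `R` has `ε ↦ ε`: `algebraMap_eps`); `isEmbeddedDeformation_iff` = the printed
  hypotheses «`B'/I'` flat over `D` and the image of `I'` in `B` is `I`»;
* `IsEmbeddedDeformation.normalVector` — Hartshorne's `φ : x ↦ ȳ` for any lift `x + εy ∈ J` (well defined by
  flatness: `sub_mem_of_mem_of_mem`; the kernel of `J → I` is `εI`: `eps_mul_inl_mem_iff`);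
* **`isEmbeddedDeformation_liftIdeal`, `normalVector_liftIdeal`, `liftIdeal_normalVector`, `equiv`,
  `existsUnique_eq_liftIdeal`** — the two constructions are inverse bijections
  `{J // IsEmbeddedDeformation I J} ≃ (I →ₗ[R] R ⧸ I)` [Hartshorne2010, Prop. 2.3].

NOT covered here (stays dictionary / binder in the (S5) files): the globalisation to a scheme and `H⁰(Y, N_{Y/X})`
(Thm. 2.4 proper: «the construction is compatible with localization»), deformations inside a NON-trivial first-order
deformation `A_ξ` of the ambient (the `H¹(N)`-obstruction `ob_{Z/A}(ξ)` of (S-B)/N″ is a Čech class built from these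
local bijections), and the branch-following criterion of (H-arr).  No scheme, sheaf, abelian variety or
semiregularity map is constructed; nothing here says that HC, HC_CM or HC_AV holds.

References: R. Hartshorne, *Deformation Theory*, GTM 257 (2010), Ch. 1 §2, Prop. 2.3 and Thm. 2.4 [corpus:
book:springernd-deformation-theory p0015–p0016, read at this seat]; E. Sernesi, *Deformations of Algebraic Schemes*,
Prop. 3.2.1.  Flatness over `k[ε]`: Matsumura Thm. 22.3 in the form of the tree file `DualNumberFlatCriterion`.
-/

open DualNumber TrivSqZeroExt

namespace Summit.Ventures.HSemireg

namespace EmbeddedDeformation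

universe u v
variable {R : Type u} [CommRing R]

/-! ### Bookkeeping in `R[ε]` -/

/-- `(εz).fst = 0`. -/
@[simp] theorem fst_eps_mul (z : R[ε]) : ((ε : R[ε]) * z).fst = 0 := by
  simp [fst_mul]

/-- `(εz).snd = z.fst`. -/
@[simp] theorem snd_eps_mul (z : R[ε]) : ((ε : R[ε]) * z).snd = z.fst := by
  simp

/-- `(x + εy).fst = x`. -/
@[simp] theorem fst_inl_add_eps_mul_inl (x y : R) : (inl x + (ε : R[ε]) * inl y).fst = x := by
  simp [fst_add]

/-- `(x + εy).snd = y`. -/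
@[simp] theorem snd_inl_add_eps_mul_inl (x y : R) : (inl x + (ε : R[ε]) * inl y).snd = y := by
  simp [snd_add]

/-- Every `z ∈ R[ε]` is `z.fst + ε z.snd` (the splitting `B' = B ⊕ tB`). -/
theorem eq_inl_add_eps_mul_inl (z : R[ε]) : z = inl z.fst + (ε : R[ε]) * inl z.snd := by
  ext <;> simp [fst_add, snd_add]

/-! ### Hartshorne's ideal `I' = {x + ty : x ∈ I, ȳ = φ(x)}` -/

/-- **The first-order lift of `I` with normal vector `φ`**: `liftIdeal I φ = {x + εy : x ∈ I, ȳ = φ(x)} ⊆ R[ε]`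
(Hartshorne, Deformation Theory, proof of Prop. 2.3).  It is an ideal of `R[ε]`: for `c = r + εs`,
`c(x + εy) = rx + ε(ry + sx)` and `ry + sx ≡ rφ(x) = φ(rx)` modulo `I`. -/
def liftIdeal (I : Ideal R) (φ : I →ₗ[R] R ⧸ I) : Ideal R[ε] where
  carrier := {z | ∃ x : I, (x : R) = z.fst ∧ Ideal.Quotient.mk I z.snd = φ x}
  zero_mem' := ⟨0, by simp, by simp⟩
  add_mem' := by
    rintro a b ⟨xa, hxa, ha⟩ ⟨xb, hxb, hb⟩
    exact ⟨xa + xb, by simp [fst_add, hxa, hxb], by rw [snd_add, map_add, map_add, ha, hb]⟩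
  smul_mem' := by
    rintro c z ⟨x, hx, hz⟩
    refine ⟨c.fst • x, by simp [fst_mul, hx], ?_⟩
    rw [smul_eq_mul, DualNumber.snd_mul, map_add, map_mul, map_mul, ← hx,
      Ideal.Quotient.eq_zero_iff_mem.2 x.2, mul_zero, add_zero, map_smul, ← hz, Algebra.smul_def,
      Ideal.Quotient.algebraMap_eq]

/-- Membership in `I'`, by definition. -/
theorem mem_liftIdeal_iff {I : Ideal R} {φ : I →ₗ[R] R ⧸ I} {z : R[ε]} :
    z ∈ liftIdeal I φ ↔ ∃ x : I, (x : R) = z.fst ∧ Ideal.Quotient.mk I z.snd = φ x := Iff.rfl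

/-- `x + εy ∈ I'` iff `x ∈ I` and `ȳ = φ(x)`. -/
theorem inl_add_eps_mul_inl_mem_liftIdeal_iff {I : Ideal R} {φ : I →ₗ[R] R ⧸ I} {x y : R} :
    inl x + (ε : R[ε]) * inl y ∈ liftIdeal I φ ↔ ∃ h : x ∈ I, Ideal.Quotient.mk I y = φ ⟨x, h⟩ := by
  rw [mem_liftIdeal_iff]
  constructor
  · rintro ⟨x', hx', h⟩
    rw [fst_inl_add_eps_mul_inl] at hx'
    subst hx'
    exact ⟨x'.2, by simpa using h⟩
  · rintro ⟨hx, h⟩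
    exact ⟨⟨x, hx⟩, by simp, by simpa using h⟩

/-- The first coordinate of an element of `I'` lies in `I`. -/
theorem fst_mem_of_mem_liftIdeal {I : Ideal R} {φ : I →ₗ[R] R ⧸ I} {z : R[ε]} (hz : z ∈ liftIdeal I φ) :
    z.fst ∈ I := by
  obtain ⟨x, hx, -⟩ := hz
  exact hx ▸ x.2

/-- **`φ = 0` gives the trivial deformation**: `liftIdeal I 0 = {z : z.fst ∈ I ∧ z.snd ∈ I} = I ⊕ εI`. -/
theorem mem_liftIdeal_zero_iff {I : Ideal R} {z : R[ε]} : z ∈ liftIdeal I 0 ↔ z.fst ∈ I ∧ z.snd ∈ I := by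
  rw [mem_liftIdeal_iff]
  constructor
  · rintro ⟨x, hx, h⟩
    rw [LinearMap.zero_apply, Ideal.Quotient.eq_zero_iff_mem] at h
    exact ⟨hx ▸ x.2, h⟩
  · rintro ⟨h1, h2⟩
    exact ⟨⟨z.fst, h1⟩, rfl, by rw [LinearMap.zero_apply, Ideal.Quotient.eq_zero_iff_mem]; exact h2⟩

/-- **The trivial deformation is `I·R[ε]`** (Hartshorne: «`φ = 0` corresponds to the trivial deformation given by
`I' = I ⊕ tI` inside `B' ≅ B ⊕ tB`»). -/
theorem liftIdeal_zero (I : Ideal R) : liftIdeal I 0 = I.map (algebraMap R R[ε]) := by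
  apply le_antisymm
  · intro z hz
    rw [mem_liftIdeal_zero_iff] at hz
    rw [eq_inl_add_eps_mul_inl z]
    have h1 : (inl z.fst : R[ε]) ∈ I.map (algebraMap R R[ε]) := Ideal.mem_map_of_mem _ hz.1
    have h2 : (inl z.snd : R[ε]) ∈ I.map (algebraMap R R[ε]) := Ideal.mem_map_of_mem _ hz.2
    exact Ideal.add_mem _ h1 (Ideal.mul_mem_left _ _ h2)
  · rw [Ideal.map_le_iff_le_comap]
    intro x hx
    rw [Ideal.mem_comap, TrivSqZeroExt.algebraMap_eq_inl', mem_liftIdeal_zero_iff]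
    exact ⟨by simpa using hx, by simp⟩

/-! ### Embedded first-order deformations and their normal vectors -/

/-- **`J ⊆ R[ε]` is an embedded first-order deformation of `V(I) ⊂ Spec R` (inside the trivial deformation
`Spec R[ε]`)**: the image of `J` under `R[ε] → R` is `I` (`fst_mem`, `exists_mem`), and `R[ε]/J` is flat over
the dual numbers, in the intrinsic form `(J : ε) = J + εR[ε]` (`eps_flat`; see `eps_flat_iff_flat`).
[Hartshorne2010, §2, «a closed subscheme `Y' ⊆ X × D`, flat over `D`, such that `Y' ×_D k = Y`», affine case] -/
structure IsEmbeddedDeformation (I : Ideal R) (J : Ideal R[ε]) : Prop where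
  fst_mem : ∀ z ∈ J, z.fst ∈ I
  exists_mem : ∀ x ∈ I, ∃ y : R, inl x + (ε : R[ε]) * inl y ∈ J
  eps_flat : ∀ z : R[ε], (ε : R[ε]) * z ∈ J → ∃ w : R[ε], z - (ε : R[ε]) * w ∈ J

/-- «The image of `J` in `R` is `I`» as an equation of ideals: `J.map fst = I`. -/
theorem map_fstHom_eq_iff {I : Ideal R} {J : Ideal R[ε]} :
    J.map (fstHom R R R) = I ↔ (∀ z ∈ J, z.fst ∈ I) ∧ (∀ x ∈ I, ∃ y : R, inl x + (ε : R[ε]) * inl y ∈ J) := by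
  have hsurj : Function.Surjective (fstHom R R R) := fun r => ⟨inl r, by simp [fstHom]⟩
  constructor
  · intro h
    refine ⟨fun z hz => ?_, fun x hx => ?_⟩
    · rw [← h]
      exact Ideal.mem_map_of_mem (fstHom R R R) hz
    · rw [← h, Ideal.mem_map_iff_of_surjective _ hsurj] at hx
      obtain ⟨z, hz, hzx⟩ := hx
      refine ⟨z.snd, ?_⟩
      have : inl x + (ε : R[ε]) * inl z.snd = z := by
        rw [← show z.fst = x from hzx, ← eq_inl_add_eps_mul_inl]
      rw [this]
      exact hz
  · rintro ⟨h1, h2⟩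
    apply le_antisymm
    · exact Ideal.map_le_iff_le_comap.2 fun z hz => h1 z hz
    · intro x hx
      obtain ⟨y, hy⟩ := h2 x hx
      rw [Ideal.mem_map_iff_of_surjective _ hsurj]
      exact ⟨_, hy, by simp [fstHom, fst_add]⟩

namespace IsEmbeddedDeformation

variable {I : Ideal R} {J : Ideal R[ε]}

/-- Flatness at work: if `εz ∈ J` then `z.fst ∈ I`. -/
theorem fst_mem_of_eps_mul_mem (hJ : IsEmbeddedDeformation I J) {z : R[ε]} (h : (ε : R[ε]) * z ∈ J) :
    z.fst ∈ I := by
  obtain ⟨w, hw⟩ := hJ.eps_flat z h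
  simpa [fst_sub, fst_mul] using hJ.fst_mem _ hw

/-- **The kernel of `J → I` is `εI`**: `εy ∈ J ⟺ y ∈ I` (the exact sequence `0 → I →ᵗ I' → I → 0` of the
printed proof). -/
theorem eps_mul_inl_mem_iff (hJ : IsEmbeddedDeformation I J) {y : R} : (ε : R[ε]) * inl y ∈ J ↔ y ∈ I := by
  refine ⟨fun h => by simpa using hJ.fst_mem_of_eps_mul_mem h, fun hy => ?_⟩
  · obtain ⟨c, hc⟩ := hJ.exists_mem y hy
    have : (ε : R[ε]) * inl y = ε * (inl y + ε * inl c) := by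
      rw [mul_add, ← mul_assoc, eps_mul_eps, zero_mul, add_zero]
    rw [this]
    exact J.mul_mem_left _ hc

/-- **Well-definedness of `x ↦ ȳ`**: two lifts `x + εy, x + εy' ∈ J` of the same `x` have `y ≡ y'` modulo `I`
(«two liftings differ by something of the form `tz` with `z ∈ I`»). -/
theorem sub_mem_of_mem_of_mem (hJ : IsEmbeddedDeformation I J) {x y y' : R}
    (hy : inl x + (ε : R[ε]) * inl y ∈ J) (hy' : inl x + (ε : R[ε]) * inl y' ∈ J) : y - y' ∈ I := by
  have h : (ε : R[ε]) * inl (y - y') ∈ J := by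
    have e : (ε : R[ε]) * inl (y - y') = (inl x + ε * inl y) - (inl x + ε * inl y') := by
      ext <;> simp [fst_sub, snd_sub]
    rw [e]
    exact J.sub_mem hy hy'
  exact (hJ.eps_mul_inl_mem_iff).1 h

/-- A chosen lift `y` of `x ∈ I` (`x + εy ∈ J`). -/
noncomputable def lift (hJ : IsEmbeddedDeformation I J) (x : I) : R := (hJ.exists_mem x x.2).choose

/-- The chosen lift lies in `J`. -/
theorem lift_spec (hJ : IsEmbeddedDeformation I J) (x : I) : inl (x : R) + (ε : R[ε]) * inl (hJ.lift x) ∈ J :=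
  (hJ.exists_mem x x.2).choose_spec

/-- **The normal vector of an embedded first-order deformation** (Hartshorne's `φ : I → B/I`, `x ↦ ȳ` for any lift
`x + ty ∈ I'`): an `R`-linear map `I → R/I`. -/
noncomputable def normalVector (hJ : IsEmbeddedDeformation I J) : I →ₗ[R] R ⧸ I where
  toFun x := Ideal.Quotient.mk I (hJ.lift x)
  map_add' x x' := by
    rw [← map_add, Ideal.Quotient.eq]
    refine hJ.sub_mem_of_mem_of_mem (hJ.lift_spec (x + x')) ?_
    have e : inl ((x + x' : I) : R) + (ε : R[ε]) * inl (hJ.lift x + hJ.lift x') =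
        (inl (x : R) + ε * inl (hJ.lift x)) + (inl (x' : R) + ε * inl (hJ.lift x')) := by
      ext <;> simp [fst_add, snd_add]
    rw [e]
    exact J.add_mem (hJ.lift_spec x) (hJ.lift_spec x')
  map_smul' r x := by
    rw [RingHom.id_apply, Algebra.smul_def, Ideal.Quotient.algebraMap_eq, ← map_mul, Ideal.Quotient.eq]
    refine hJ.sub_mem_of_mem_of_mem (hJ.lift_spec (r • x)) ?_
    have e : inl ((r • x : I) : R) + (ε : R[ε]) * inl (r * hJ.lift x) =
        inl r * (inl (x : R) + ε * inl (hJ.lift x)) := by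
      ext <;> simp [fst_add, snd_add, fst_mul]
    rw [e]
    exact J.mul_mem_left _ (hJ.lift_spec x)

/-- The normal vector does not depend on the lift: `φ(x) = ȳ` for ANY `y` with `x + εy ∈ J`. -/
theorem normalVector_apply_eq (hJ : IsEmbeddedDeformation I J) {x : I} {y : R}
    (h : inl (x : R) + (ε : R[ε]) * inl y ∈ J) : hJ.normalVector x = Ideal.Quotient.mk I y := by
  change Ideal.Quotient.mk I (hJ.lift x) = _
  rw [Ideal.Quotient.eq]
  exact hJ.sub_mem_of_mem_of_mem (hJ.lift_spec x) h

/-- `z ∈ J ⟹ φ(z.fst) = z.snd mod I`. -/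
theorem normalVector_apply_of_mem (hJ : IsEmbeddedDeformation I J) {z : R[ε]} (hz : z ∈ J) :
    hJ.normalVector ⟨z.fst, hJ.fst_mem z hz⟩ = Ideal.Quotient.mk I z.snd :=
  hJ.normalVector_apply_eq (by rw [← eq_inl_add_eps_mul_inl]; exact hz)

end IsEmbeddedDeformation

/-! ### The two constructions are inverse to each other (Hartshorne, Prop. 2.3) -/

/-- **`I'` is an embedded first-order deformation**: its image in `R` is `I` (every `φ(x)` has a representative
`y`), and `R[ε]/I'` is flat — if `εz ∈ I'` then `z.fst ∈ I` (as `0̄ = φ(0)` forces `z.fst ∈ I`), and then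
`z - ε(z.snd - y) ∈ I'` for any representative `y` of `φ(z.fst)`. -/
theorem isEmbeddedDeformation_liftIdeal (I : Ideal R) (φ : I →ₗ[R] R ⧸ I) :
    IsEmbeddedDeformation I (liftIdeal I φ) where
  fst_mem _ hz := fst_mem_of_mem_liftIdeal hz
  exists_mem x hx := by
    obtain ⟨y, hy⟩ := Ideal.Quotient.mk_surjective (φ ⟨x, hx⟩)
    exact ⟨y, inl_add_eps_mul_inl_mem_liftIdeal_iff.2 ⟨hx, hy⟩⟩
  eps_flat z hz := by
    obtain ⟨x, hx, hφ⟩ := hz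
    have hx0 : x = 0 := Subtype.ext (by simpa using hx)
    rw [hx0, map_zero, snd_eps_mul, Ideal.Quotient.eq_zero_iff_mem] at hφ
    obtain ⟨y, hy⟩ := Ideal.Quotient.mk_surjective (φ ⟨z.fst, hφ⟩)
    exact ⟨inl (z.snd - y), ⟨z.fst, hφ⟩, by simp [fst_sub, fst_mul], by simp [← hy, snd_sub]⟩

/-- **`φ ↦ I' ↦ φ` is the identity**: the normal vector of `liftIdeal I φ` is `φ`. -/
theorem normalVector_liftIdeal (I : Ideal R) (φ : I →ₗ[R] R ⧸ I) :
    (isEmbeddedDeformation_liftIdeal I φ).normalVector = φ := by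
  ext x
  obtain ⟨y, hy⟩ := Ideal.Quotient.mk_surjective (φ x)
  have h : inl (x : R) + (ε : R[ε]) * inl y ∈ liftIdeal I φ :=
    inl_add_eps_mul_inl_mem_liftIdeal_iff.2 ⟨x.2, by simpa using hy⟩
  rw [(isEmbeddedDeformation_liftIdeal I φ).normalVector_apply_eq h, hy]

/-- **`J ↦ φ ↦ I'` is the identity**: an embedded first-order deformation is recovered from its normal vector.
(`⊇`: `z = z.fst + ε z.snd ∈ J` has `φ(z.fst) = z.snd mod I` by definition; `⊆`: if `z.snd ≡ y` with
`z.fst + εy ∈ J`, then `z = (z.fst + εy) + ε(z.snd - y)` and `ε(z.snd - y) ∈ J` because `z.snd - y ∈ I`.) -/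
theorem liftIdeal_normalVector {I : Ideal R} {J : Ideal R[ε]} (hJ : IsEmbeddedDeformation I J) :
    liftIdeal I hJ.normalVector = J := by
  ext z
  constructor
  · rintro ⟨x, hx, hφ⟩
    obtain ⟨y, hy⟩ := hJ.exists_mem x x.2
    rw [hJ.normalVector_apply_eq hy, Ideal.Quotient.eq] at hφ
    have h2 : (ε : R[ε]) * inl (z.snd - y) ∈ J := (hJ.eps_mul_inl_mem_iff).2 hφ
    rw [show z = (inl (x : R) + (ε : R[ε]) * inl y) + ε * inl (z.snd - y) by ext <;> simp [fst_add, snd_add, hx]]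
    exact J.add_mem hy h2
  · intro hz
    exact ⟨⟨z.fst, hJ.fst_mem z hz⟩, rfl, (hJ.normalVector_apply_of_mem hz).symm⟩

/-- **Hartshorne, *Deformation Theory*, Prop. 2.3 (affine embedded first-order deformations).**  For every
commutative ring `R` and every ideal `I ⊆ R`: the embedded first-order deformations of `V(I) ⊂ Spec R` inside
`Spec R[ε]` — ideals `J ⊆ R[ε]` with image `I` in `R` and `R[ε]/J` flat over the dual numbers — correspond
bijectively to `Hom_R(I, R/I)`, by `J ↦` (normal vector `x ↦ ȳ`, `x + εy ∈ J`) and `φ ↦ {x + εy : ȳ = φ(x)}`;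
`0 ↦` the trivial deformation (`liftIdeal_zero`).  [cite: Hartshorne2010, §2 Prop. 2.3] -/
noncomputable def equiv (I : Ideal R) : {J : Ideal R[ε] // IsEmbeddedDeformation I J} ≃ (I →ₗ[R] R ⧸ I) where
  toFun J := J.2.normalVector
  invFun φ := ⟨liftIdeal I φ, isEmbeddedDeformation_liftIdeal I φ⟩
  left_inv J := Subtype.ext (liftIdeal_normalVector J.2)
  right_inv φ := normalVector_liftIdeal I φ

/-- The inverse bijection is `φ ↦ I'`. -/
@[simp] theorem equiv_symm_apply (I : Ideal R) (φ : I →ₗ[R] R ⧸ I) :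
    ((equiv I).symm φ : Ideal R[ε]) = liftIdeal I φ := rfl

/-- Two embedded first-order deformations with the same normal vector are equal. -/
theorem IsEmbeddedDeformation.eq_of_normalVector_eq {I : Ideal R} {J J' : Ideal R[ε]}
    (hJ : IsEmbeddedDeformation I J) (hJ' : IsEmbeddedDeformation I J')
    (h : hJ.normalVector = hJ'.normalVector) : J = J' := by
  rw [← liftIdeal_normalVector hJ, ← liftIdeal_normalVector hJ', h]

/-- The trivial deformation `I·R[ε]` is an embedded first-order deformation with normal vector `0`. -/
theorem isEmbeddedDeformation_map (I : Ideal R) : IsEmbeddedDeformation I (I.map (algebraMap R R[ε])) := by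
  rw [← liftIdeal_zero]
  exact isEmbeddedDeformation_liftIdeal I 0

/-- The normal vector of the trivial deformation is `0`. -/
theorem normalVector_map (I : Ideal R) : (isEmbeddedDeformation_map I).normalVector = 0 := by
  have : ∀ {J : Ideal R[ε]} (hJ : IsEmbeddedDeformation I J), J = liftIdeal I 0 → hJ.normalVector = 0 := by
    rintro J hJ rfl
    exact normalVector_liftIdeal I 0
  exact this _ (liftIdeal_zero I).symm

/-! ### Flatness over `k[ε]`: the intrinsic condition is `Module.Flat` -/

section Flat

variable {k : Type v} [Field k]

/-- **`(J : ε) = J + εR[ε]` iff `R[ε]/J` is flat over `k[ε]`**, for ANY `k[ε]`-algebra structure on `R[ε]` under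
which `ε ↦ ε` (`k` a field; Matsumura Thm. 22.3 in the form `DualNumberFlat.flat_iff_forall_exists_eq_eps_smul`). -/
theorem eps_flat_iff_flat [Algebra k[ε] R[ε]] (hε : algebraMap k[ε] R[ε] ε = ε) (J : Ideal R[ε]) :
    (∀ z : R[ε], (ε : R[ε]) * z ∈ J → ∃ w : R[ε], z - (ε : R[ε]) * w ∈ J) ↔ Module.Flat k[ε] (R[ε] ⧸ J) := by
  rw [DualNumberFlat.flat_iff_forall_exists_eq_eps_smul]
  have key : ∀ z : R[ε], (ε : k[ε]) • (Ideal.Quotient.mk J z) = Ideal.Quotient.mk J (ε * z) := by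
    intro z
    rw [← hε, ← Algebra.smul_def]
    exact (Submodule.Quotient.mk_smul J (ε : k[ε]) z).symm
  constructor
  · intro h q hq
    obtain ⟨z, rfl⟩ := Ideal.Quotient.mk_surjective q
    rw [key, Ideal.Quotient.eq_zero_iff_mem] at hq
    obtain ⟨w, hw⟩ := h z hq
    refine ⟨Ideal.Quotient.mk J w, ?_⟩
    rw [key, Ideal.Quotient.eq, ← Ideal.neg_mem_iff, neg_sub]
    exact hw
  · intro h z hz
    obtain ⟨q, hq⟩ := h (Ideal.Quotient.mk J z) (by rw [key, Ideal.Quotient.eq_zero_iff_mem]; exact hz)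
    obtain ⟨w, rfl⟩ := Ideal.Quotient.mk_surjective q
    rw [key, Ideal.Quotient.eq, ← Ideal.neg_mem_iff, neg_sub] at hq
    exact ⟨w, hq⟩

/-- **The structure ⟺ the printed hypotheses**: `J` is an embedded first-order deformation of `V(I)` iff the image
of `J` in `R` is `I` and `R[ε]/J` is flat over `k[ε]` (any `k[ε]`-algebra structure with `ε ↦ ε`, `k` a field).
[Hartshorne2010, Prop. 2.3: «`I' ⊆ B'` such that `B'/I'` is flat over `D` and the image of `I'` in `B` is `I`»] -/
theorem isEmbeddedDeformation_iff [Algebra k[ε] R[ε]] (hε : algebraMap k[ε] R[ε] ε = ε) {I : Ideal R}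
    {J : Ideal R[ε]} :
    IsEmbeddedDeformation I J ↔ J.map (fstHom R R R) = I ∧ Module.Flat k[ε] (R[ε] ⧸ J) := by
  rw [map_fstHom_eq_iff, ← eps_flat_iff_flat hε]
  exact ⟨fun h => ⟨⟨h.fst_mem, h.exists_mem⟩, h.eps_flat⟩, fun h => ⟨h.1.1, h.1.2, h.2⟩⟩

/-- **The canonical `k[ε]`-algebra structure on `R[ε]`** for a `k`-algebra `R` (`R[ε] = R ⊗_k k[ε]`): the unique
`k`-algebra map `k[ε] → R[ε]` with `ε ↦ ε` (`DualNumber.lift`). -/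
@[reducible] noncomputable def algebraDualNumber (k : Type v) (R : Type u) [Field k] [CommRing R]
    [Algebra k R] : Algebra k[ε] R[ε] :=
  (DualNumber.lift
      ⟨(Algebra.ofId k R[ε], (ε : R[ε])), eps_mul_eps, fun _ => commute_eps_left _⟩ :
      k[ε] →ₐ[k] R[ε]).toRingHom.toAlgebra

/-- Under the canonical structure, `ε ↦ ε`. -/
theorem algebraMap_eps (k : Type v) (R : Type u) [Field k] [CommRing R] [Algebra k R] :
    letI := algebraDualNumber k R
    algebraMap k[ε] R[ε] ε = ε := by
  letI := algebraDualNumber k R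
  show (DualNumber.lift
      ⟨(Algebra.ofId k R[ε], (ε : R[ε])), eps_mul_eps, fun _ => commute_eps_left _⟩ : k[ε] →ₐ[k] R[ε]) ε = ε
  rw [DualNumber.lift_apply_eps]

/-- **Prop. 2.3 with the printed hypotheses, canonical structure**: for a `k`-algebra `R` (`k` a field), an ideal
`J ⊆ R[ε]` with image `I` in `R` and `R[ε]/J` flat over `k[ε]` is `liftIdeal I φ` for a unique `φ ∈ Hom_R(I, R/I)`. -/
theorem existsUnique_eq_liftIdeal (k : Type v) [Field k] [Algebra k R] {I : Ideal R} {J : Ideal R[ε]}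
    (hmap : J.map (fstHom R R R) = I)
    (hflat : letI := algebraDualNumber k R; Module.Flat k[ε] (R[ε] ⧸ J)) :
    ∃! φ : I →ₗ[R] R ⧸ I, J = liftIdeal I φ := by
  letI := algebraDualNumber k R
  have hJ : IsEmbeddedDeformation I J := (isEmbeddedDeformation_iff (algebraMap_eps k R)).2 ⟨hmap, hflat⟩
  refine ⟨hJ.normalVector, (liftIdeal_normalVector hJ).symm, fun φ hφ => ?_⟩
  subst hφ
  exact (normalVector_liftIdeal I φ).symm

end Flat

end EmbeddedDeformation

end Summit.Ventures.HSemireg
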